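import Summits.QuantumFields.BalabanUV.Beta.SymAveragingMixedJetTables
import Summits.QuantumFields.BalabanUV.Beta.SymAveragingHessianCounts
import Summits.QuantumFields.BalabanUV.Beta.MultiplierTableSlot
import Summits.QuantumFields.BalabanUV.Beta.MixedWardPacking

/-!
# `BalabanUV.Beta.SymMixedWardPacking` — THE PACKING ADAPTER FROM THE BOND-LEVEL WARD LAW OF THE (0.4)-SYMMETRISED MIXED TABLE TO THE THREE
# MIXED WARD BINDERS AT LEVEL 0 (`hclsW₀`, `hRW₀p`, `hM₂0` shapes) OF THE SYM ROW ROOT, ROOT `ctr 4 Lc` (β sub-cell, row D1, TABLES-SYM-LEAN S2d,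
# INTERFACE-LEVEL twin of the row owner's K-W1 `MixedWardPacking` §1–§5; an1 gen 43; the mixed WARD path toward the sym root's (T2-M₂) letter)

HONEST FRAMING (cell charter, verbatim): «discharging BetaPertH makes Bałaban's UV stability UNCONDITIONAL — a real
constructive-QFT result; it is NOT the continuum limit and NOT the Clay problem.»  HONEST DEPENDENCY (verbatim): «continuum YM on
T⁴ ⇐ BetaPertH ∧ nine spine estimates (0/9 proved); BetaPertH ⇐ (D1) ∧ (D4) ∧ CAP+tail; G-an2-4 gates asym, D1 and NE2/3/4.»
ABSOLUTE RULE (R-g25-7 ∕ R-D1-g30-1 (A)): the (0.4)-symmetrised averaging is the exp of the MEAN OF LOGS over the pair family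
`{loop^{σ,σ′}}` with weight `((d!)²·L^d)⁻¹`; every object below is the comb module's algebra read on an1's `symPhiGAt` (S2b part 1)
instead of `PhiGAt` — STATEMENT FOR STATEMENT under the dictionary `PhiXAt ↦ symPhiXAt`, `XjetAt ↦ symXjetAt`, `MσXAt ↦ symMσXAt`,
`L^{-d}·linAvgAt ↦ (d!·L^d)⁻¹·symLinU`, `L^{-d}·hessUAt ↦ ((d!)²L^d)⁻¹·symHessUAt`, `L^{-2d}·vhUAt ↦ ((d!)²L^{2d})⁻¹·symVhUAt`
(an3-g63 [AN3-G63-S2C] (C-ii): constants PER BCH ORDER; CONVENTION `(d!)²` un-normalised inside order-2 sym functionals).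
FAMILY-INDEPENDENT chart ∕ letter ∕ `Tau`-algebra lemmas of the comb module are imported BY NAME, never re-proved.
DERIVED cell leaf: [folklore] ring algebra; the `sym*` families are [our object]s.  No statement of Bałaban's papers is typed here, no
`[cite:]` tag, no `Prop` is minted, no binder of the β-function wall (`hW`/`hR`/`D1Tel`/`D1Rep`, (D1), `BetaPertH`) is instantiated or
discharged; nothing about the VALUES of `symMixFFAt`∕`symVh₂SAt` and no (T2-B)∕(T2-M₂) letter is discharged in this file.
NOT D1, NOT BetaPertH, NOT continuum, NOT Clay.  NOT summit progress.
Provenance: β sub-cell, TABLES-SYM-LEAN S2c option (C) (S2C-SCOPE-v1 94facb80ac685517), unit b2b-balaban-beta-an1-g43 (W-supplier AN1,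
FREEZE (0): scratch for a courier; an1 files nothing), 2026-08-21; no existing file touched.

## What this module proves (sym twin of `MixedWardPacking` §1–§5, token for token under `mixFFAt mixKerAt mixAbs hessFFAt hessKerAt ↦ symMixFFAt symMixKerAt
## symMixAbs symHessFFAt symHessKerAt`, `M1At 3 Lc ρ_c ↦ M1Of 3 Lc (symHessFFAt ρ_c Lc)`, root `toSite (ctrOff 4 Lc) ↦ ctr 4 Lc`; §6 (the COMB literal `JsRowD1Pin`) is
## NOT twinned; `biLoc_absorb` is the comb module's BY NAME)
* §1 `symWardM`, `symDatM`, `symRWof := symWardM − symDatM` and **`wardMixed_symRWof`**: the level-0 mixed Ward letter of the sym row root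
  (`RowD1JointEndSymReflTablesAn1S2`'s `hM₂` at `j = 0`, `mixFF := symMixFFAt (ctr 4 Lc) Lc`, `M := M1Of 3 Lc (symHessFFAt (ctr 4 Lc) Lc) cΛ`) holds for
  `RM 0 := symRWof Lc cΛ` BY DEFINITION.
* §2 entrywise forms; §3 **`parityOdd_symRWof_of_bondLaw`**: (WM-bond)_sym ⟹ `trK (symRWof …) = −sgnK (symRWof …)`; §4 **`vertexFamily_symRWof`** (no hypothesis);
  §5 **`mixedWardBinders_of_bondLaw`**: (WM-bond)_sym ⟹ the three level-0 mixed Ward binders.  (WM-bond)_sym is a HYPOTHESIS here; it is the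
  conclusion of an1's `SymMixedWardSiteLaw.symBondWardM` at `cΛ = 2∕Lc⁴` (separate file).
-/

open Finset
open scoped BigOperators
open Literature.MathematicalPhysics.QuantumFieldTheory
open Literature.MathematicalPhysics.QuantumFieldTheory.Balaban1983to89
open Literature.MathematicalPhysics.QuantumFieldTheory.Balaban1983to89.Beta
open B12Sec2to5 (l1 l1_nonneg)
open B6BondElimination (unitVec)
open ExpKernelCalculus (MKer BiLoc VertexFamily comp shiftK l1_sub_triangle l1_sub_symm)
open KernelWard (divV)
open AffineAveraging (box toSite)
open AveragingContoursRooted (ctr ctrOff ctrOff_mem_box)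
open AveragingHessianKernels (ell)
open Summit.QuantumFields.BalabanUV.Beta.SymAveragingHessianCounts (symHessFFAt symHessKerAt symHessKerAt_swap symHessFFAt_inl_inl symHessFFAt_inl_inr
  symHessFFAt_inr biLoc_symHessFFAt)
open Summit.QuantumFields.BalabanUV.Beta.SymAveragingMixedJetTables (symMixFFAt symMixKerAt symMixAbs symMixAbs_nonneg symMixFFAt_inl_inl
  symMixFFAt_inl_inr symMixFFAt_inr biLoc_symMixFFAt)
open OneStepResolventKernel (Fib biLoc_finset_sum)
open KernelWard (biLoc_add biLoc_sub)
open StepJetData (biLoc_weaken biLoc_smul)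
open BalabanStepW2 (M2Of wM1 wM2)
open Summit.QuantumFields.BalabanUV.Beta.TameKernelCalculus
open Summit.QuantumFields.BalabanUV.Beta.BorderedHessian (diagK diagK_apply comp_diagK_left comp_diagK_right stepScale sgnK sgnK_apply sgnF)
open Summit.QuantumFields.BalabanUV.Beta.AveragingWardRootedStencils (legInd legInd_apply legInd_inl)
open Summit.QuantumFields.BalabanUV.Beta.SpineRooted (M1Of)
open Summit.QuantumFields.BalabanUV.Beta.WardLocusStencils (divV_apply)
open Summit.QuantumFields.BalabanUV.Beta.WardLocusParityLevels (M2Of_apply)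
open Summit.QuantumFields.BalabanUV.Beta.MixedWardPacking (biLoc_absorb)

namespace Summit.QuantumFields.BalabanUV.Beta.SymMixedWardPacking

noncomputable section

variable {Lc : ℕ} [NeZero Lc]

/-! ## §1 The letter's two sides, the forced residual, and the letter by definition -/

/-- [our object] **THE LEFT SIDE OF (W-M₀)_sym AT an1's (0.4)-SYMMETRISED MIXED TABLE**: the block divergence (coarse site `y`) of `M2Of 3 Lc (symMixFFAt ρ_c Lc) 0 · · ρ′ w`,
prefactor `(stepScale 0 · Lc⁴)⁻¹` — verbatim the binder's left side. -/
def symWardM (Lc : ℕ) [NeZero Lc] (y : Fin (3 + 1) → ℤ) (ρ' : Fin (3 + 1)) (w : Fin (3 + 1) → ℤ) : MKer (3 + 1) (Fib 3) :=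
  (stepScale 3 Lc 0 * (Lc : ℝ) ^ (3 + 1))⁻¹ •
    ∑ v ∈ box (3 + 1) Lc, divV (fun κ u => M2Of 3 Lc (symMixFFAt (ctr 4 Lc) Lc) 0 κ u ρ' w) ((Lc : ℤ) • y + toSite v)

/-- [our object] **THE COMMUTATOR DATUM OF (W-M₀)_sym**: `[M1Of 3 Lc (symHessFFAt ρ_c Lc) cΛ 0 ρ′ w, diagK (½ Σ_v legInd ρ_c (Lc•y + v))]` — verbatim the binder's datum. -/
def symDatM (Lc : ℕ) [NeZero Lc] (cΛ : ℝ) (y : Fin (3 + 1) → ℤ) (ρ' : Fin (3 + 1)) (w : Fin (3 + 1) → ℤ) : MKer (3 + 1) (Fib 3) :=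
  comp (M1Of 3 Lc (symHessFFAt (ctr 4 Lc) Lc) cΛ 0 ρ' w)
      (diagK (((1 : ℝ) / 2) • ∑ v ∈ box (3 + 1) Lc, legInd (ctr 4 Lc) ((Lc : ℤ) • y + toSite v)))
    - comp (diagK (((1 : ℝ) / 2) • ∑ v ∈ box (3 + 1) Lc, legInd (ctr 4 Lc) ((Lc : ℤ) • y + toSite v)))
      (M1Of 3 Lc (symHessFFAt (ctr 4 Lc) Lc) cΛ 0 ρ' w)

/-- [our object] **THE RESIDUAL FORCED BY THE LETTER**: `symRWof Lc cΛ y ρ′ w := symWardM Lc y ρ′ w − symDatM Lc cΛ y ρ′ w`. -/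
def symRWof (Lc : ℕ) [NeZero Lc] (cΛ : ℝ) : (Fin (3 + 1) → ℤ) → Fin (3 + 1) → (Fin (3 + 1) → ℤ) → MKer (3 + 1) (Fib 3) :=
  fun y ρ' w => symWardM Lc y ρ' w - symDatM Lc cΛ y ρ' w

/-- [folklore] **(W-M₀) HOLDS FOR `RW₀ := symRWof Lc cΛ` BY DEFINITION** — the binder `hM₂` of `RowD1JointEndSymReflTablesAn1S2` at `j = 0` VERBATIM
(`mixFF := symMixFFAt ρ_c Lc`, `RM 0 := symRWof Lc cΛ`); its content has moved into the class (§4) and the parity (§3) of `symRWof`. -/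
theorem symWardMixed_symRWof (cΛ : ℝ) (y : Fin (3 + 1) → ℤ) (ρ' : Fin (3 + 1)) (w : Fin (3 + 1) → ℤ) :
    (stepScale 3 Lc 0 * (Lc : ℝ) ^ (3 + 1))⁻¹ • ∑ v ∈ box (3 + 1) Lc,
        divV (fun κ u => M2Of 3 Lc (symMixFFAt (ctr 4 Lc) Lc) 0 κ u ρ' w) ((Lc : ℤ) • y + toSite v) =
      comp (M1Of 3 Lc (symHessFFAt (ctr 4 Lc) Lc) cΛ 0 ρ' w) (diagK (((1 : ℝ) / 2) • ∑ v ∈ box (3 + 1) Lc, legInd (ctr 4 Lc) ((Lc : ℤ) • y + toSite v)))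
        - comp (diagK (((1 : ℝ) / 2) • ∑ v ∈ box (3 + 1) Lc, legInd (ctr 4 Lc) ((Lc : ℤ) • y + toSite v))) (M1Of 3 Lc (symHessFFAt (ctr 4 Lc) Lc) cΛ 0 ρ' w)
        + symRWof Lc cΛ y ρ' w := by
  show symWardM Lc y ρ' w = symDatM Lc cΛ y ρ' w + (symWardM Lc y ρ' w - symDatM Lc cΛ y ρ' w)
  abel

/-! ## §2 Entrywise forms -/
/-- [folklore] The field–field entries of the left side: `Lc⁻⁴ · Σ_{v,κ} (t_{(ρ′,w)}(f,f′;(κ, s_v − e_κ)) − t_{(ρ′,w)}(f,f′;(κ, s_v)))` over an1's `symMixKerAt`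
(`stepScale 0 = 1`, `wM2 0 = 1`, `s_v = Lc•y + v`, `f = (β,x)`, `f′ = (β′,x′)`). -/
theorem symWardM_inl_inl (y : Fin (3 + 1) → ℤ) (ρ' : Fin (3 + 1)) (w x x' : Fin (3 + 1) → ℤ) (β β' : Fin (3 + 1)) :
    symWardM Lc y ρ' w x x' (Sum.inl β) (Sum.inl β') =
      ((Lc : ℝ) ^ (3 + 1))⁻¹ * ∑ v ∈ box (3 + 1) Lc, ∑ κ : Fin (3 + 1),
        (symMixKerAt (ctr 4 Lc) Lc ρ' w (κ, (Lc : ℤ) • y + toSite v - unitVec κ) (β, x) (β', x')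
          - symMixKerAt (ctr 4 Lc) Lc ρ' w (κ, (Lc : ℤ) • y + toSite v) (β, x) (β', x')) := by
  have h1 : stepScale 3 Lc 0 = 1 := by simp [BorderedHessian.stepScale]
  have h2 : wM2 3 Lc 0 = 1 := by simp [BalabanStepW2.wM2]
  simp only [symWardM, h1, one_mul, Pi.smul_apply, Finset.sum_apply, smul_eq_mul, divV_apply, M2Of_apply, h2, one_smul, symMixFFAt_inl_inl]

/-- [folklore] The left side vanishes on `(inl, inr)`. -/
theorem symWardM_inl_inr (y : Fin (3 + 1) → ℤ) (ρ' : Fin (3 + 1)) (w x x' : Fin (3 + 1) → ℤ) (β μ : Fin (3 + 1)) :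
    symWardM Lc y ρ' w x x' (Sum.inl β) (Sum.inr μ) = 0 := by
  simp only [symWardM, Pi.smul_apply, Finset.sum_apply, smul_eq_mul, divV_apply, M2Of_apply, symMixFFAt_inl_inr,
    sub_self, Finset.sum_const_zero, mul_zero]

/-- [folklore] The left side vanishes on `(inr, ·)`. -/
theorem symWardM_inr (y : Fin (3 + 1) → ℤ) (ρ' : Fin (3 + 1)) (w x x' : Fin (3 + 1) → ℤ) (μ : Fin (3 + 1)) (b : Fib 3) :
    symWardM Lc y ρ' w x x' (Sum.inr μ) b = 0 := by
  simp only [symWardM, Pi.smul_apply, Finset.sum_apply, smul_eq_mul, divV_apply, M2Of_apply, symMixFFAt_inr,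
    sub_self, Finset.sum_const_zero, mul_zero]

omit [NeZero Lc] in
/-- [folklore] `M1Of 3 Lc (symHessFFAt ρ_c Lc) cΛ` at level `0` is `cΛ • symHessFFAt ρ_c Lc` (`wM1 0 = 1`). -/
theorem symM1Of_zero (cΛ : ℝ) (ρ' : Fin (3 + 1)) (w : Fin (3 + 1) → ℤ) :
    M1Of 3 Lc (symHessFFAt (ctr 4 Lc) Lc) cΛ 0 ρ' w = cΛ • symHessFFAt (ctr 4 Lc) Lc ρ' w := by
  have h : wM1 3 Lc 0 = 1 := by simp [BalabanStepW2.wM1]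
  simp only [M1Of, h, mul_one]

/-- [folklore] The datum entrywise: `cΛ · symHessFFAt … x x′ a b · (D(x′,b) − D(x,a))`, `D := ½ Σ_v legInd ρ_c (Lc•y + v)`. -/
theorem symDatM_apply (cΛ : ℝ) (y : Fin (3 + 1) → ℤ) (ρ' : Fin (3 + 1)) (w x x' : Fin (3 + 1) → ℤ) (a b : Fib 3) :
    symDatM Lc cΛ y ρ' w x x' a b =
      cΛ * symHessFFAt (ctr 4 Lc) Lc ρ' w x x' a b *
        ((((1 : ℝ) / 2) • ∑ v ∈ box (3 + 1) Lc, legInd (ctr 4 Lc) ((Lc : ℤ) • y + toSite v)) x' b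
          - (((1 : ℝ) / 2) • ∑ v ∈ box (3 + 1) Lc, legInd (ctr 4 Lc) ((Lc : ℤ) • y + toSite v)) x a) := by
  simp only [symDatM, symM1Of_zero, Pi.sub_apply, comp_diagK_right, comp_diagK_left, Pi.smul_apply, smul_eq_mul]
  ring

/-- [folklore] The field–field entries of the datum: `cΛ · h_{(ρ′,w)}(f,f′) · (D(x′) − D(x))` with `D(x) = ½ Σ_v [x = Lc•y + v]`. -/
theorem symDatM_inl_inl (cΛ : ℝ) (y : Fin (3 + 1) → ℤ) (ρ' : Fin (3 + 1)) (w x x' : Fin (3 + 1) → ℤ) (β β' : Fin (3 + 1)) :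
    symDatM Lc cΛ y ρ' w x x' (Sum.inl β) (Sum.inl β') =
      cΛ * symHessKerAt (ctr 4 Lc) Lc ρ' w (β, x) (β', x') *
        ((1 / 2 : ℝ) * (∑ v ∈ box (3 + 1) Lc, (if x' = (Lc : ℤ) • y + toSite v then (1 : ℝ) else 0))
          - (1 / 2 : ℝ) * (∑ v ∈ box (3 + 1) Lc, (if x = (Lc : ℤ) • y + toSite v then (1 : ℝ) else 0))) := by
  rw [symDatM_apply, symHessFFAt_inl_inl]
  simp only [Pi.smul_apply, Finset.sum_apply, smul_eq_mul, legInd_inl]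

/-- [folklore] The datum vanishes on `(inl, inr)`. -/
theorem symDatM_inl_inr (cΛ : ℝ) (y : Fin (3 + 1) → ℤ) (ρ' : Fin (3 + 1)) (w x x' : Fin (3 + 1) → ℤ) (β μ : Fin (3 + 1)) :
    symDatM Lc cΛ y ρ' w x x' (Sum.inl β) (Sum.inr μ) = 0 := by
  rw [symDatM_apply, symHessFFAt_inl_inr]; ring

/-- [folklore] The datum vanishes on `(inr, ·)`. -/
theorem symDatM_inr (cΛ : ℝ) (y : Fin (3 + 1) → ℤ) (ρ' : Fin (3 + 1)) (w x x' : Fin (3 + 1) → ℤ) (μ : Fin (3 + 1)) (b : Fib 3) :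
    symDatM Lc cΛ y ρ' w x x' (Sum.inr μ) b = 0 := by
  rw [symDatM_apply, symHessFFAt_inr]; ring

/-- [folklore] The residual entrywise. -/
theorem symRWof_apply (cΛ : ℝ) (y : Fin (3 + 1) → ℤ) (ρ' : Fin (3 + 1)) (w x x' : Fin (3 + 1) → ℤ) (a b : Fib 3) :
    symRWof Lc cΛ y ρ' w x x' a b = symWardM Lc y ρ' w x x' a b - symDatM Lc cΛ y ρ' w x x' a b := rfl

/-! ## §3 The bond-level Ward law and the parity of the residual -/
/-- [folklore] **(WM-bond) ⟹ `symRWof` IS ROW-PARITY-ODD** (`trK = −sgnK`).  (WM-bond): for every coarse site `y`, coarse bond `(ρ′,w)` and fine bonds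
`f = (β,x)`, `f′ = (β′,x′)`, the `f ↔ f′`-symmetrisation of the block divergence of an1's sym mixed table equals TWICE the commutator datum:
`Lc⁻⁴·Σ_{v,κ} [(t(f,f′;κ,s_v−e_κ) − t(f,f′;κ,s_v)) + (t(f′,f;κ,s_v−e_κ) − t(f′,f;κ,s_v))] = 2·cΛ·h(f,f′)·(D(x′) − D(x))` (`t = symMixKerAt`, `h = symHessKerAt`,
`D(x) = ½Σ_v [x = s_v]`).  On the field–field block this is exactly antisymmetry of `symWardM − symDatM` (the datum is symmetric: `h` and `D(x′) − D(x)` are both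
antisymmetric); off it both sides vanish. -/
theorem parityOdd_symRWof_of_bondLaw (cΛ : ℝ)
    (hWM : ∀ (y : Fin (3 + 1) → ℤ) (ρ' : Fin (3 + 1)) (w : Fin (3 + 1) → ℤ) (β : Fin (3 + 1)) (x : Fin (3 + 1) → ℤ) (β' : Fin (3 + 1))
      (x' : Fin (3 + 1) → ℤ),
      ((Lc : ℝ) ^ (3 + 1))⁻¹ * (∑ v ∈ box (3 + 1) Lc, ∑ κ : Fin (3 + 1),
          ((symMixKerAt (ctr 4 Lc) Lc ρ' w (κ, (Lc : ℤ) • y + toSite v - unitVec κ) (β, x) (β', x')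
              - symMixKerAt (ctr 4 Lc) Lc ρ' w (κ, (Lc : ℤ) • y + toSite v) (β, x) (β', x'))
            + (symMixKerAt (ctr 4 Lc) Lc ρ' w (κ, (Lc : ℤ) • y + toSite v - unitVec κ) (β', x') (β, x)
              - symMixKerAt (ctr 4 Lc) Lc ρ' w (κ, (Lc : ℤ) • y + toSite v) (β', x') (β, x)))) =
        2 * (cΛ * symHessKerAt (ctr 4 Lc) Lc ρ' w (β, x) (β', x') *
          ((1 / 2 : ℝ) * (∑ v ∈ box (3 + 1) Lc, (if x' = (Lc : ℤ) • y + toSite v then (1 : ℝ) else 0))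
            - (1 / 2 : ℝ) * (∑ v ∈ box (3 + 1) Lc, (if x = (Lc : ℤ) • y + toSite v then (1 : ℝ) else 0))))) :
    ∀ (y : Fin (3 + 1) → ℤ) (ρ' : Fin (3 + 1)) (w : Fin (3 + 1) → ℤ), trK (symRWof Lc cΛ y ρ' w) = -sgnK (symRWof Lc cΛ y ρ' w) := by
  intro y ρ' w
  funext x x' a b
  simp only [trK_apply, Pi.neg_apply, sgnK_apply]
  rcases a with β | μ <;> rcases b with β' | μ'
  · -- field–field: antisymmetry from the bond law
    have h := hWM y ρ' w β' x' β x
    rw [BorderedHessian.sgnF_inl, BorderedHessian.sgnF_inl, one_mul, one_mul, symRWof_apply, symRWof_apply, symWardM_inl_inl, symWardM_inl_inl, symDatM_inl_inl,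
      symDatM_inl_inl, symHessKerAt_swap (ctr 4 Lc) Lc ρ' w (β, x) (β', x')]
    rw [symHessKerAt_swap (ctr 4 Lc) Lc ρ' w (β, x) (β', x')] at h
    have hsplit : ((Lc : ℝ) ^ (3 + 1))⁻¹ * (∑ v ∈ box (3 + 1) Lc, ∑ κ : Fin (3 + 1),
          ((symMixKerAt (ctr 4 Lc) Lc ρ' w (κ, (Lc : ℤ) • y + toSite v - unitVec κ) (β', x') (β, x)
              - symMixKerAt (ctr 4 Lc) Lc ρ' w (κ, (Lc : ℤ) • y + toSite v) (β', x') (β, x))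
            + (symMixKerAt (ctr 4 Lc) Lc ρ' w (κ, (Lc : ℤ) • y + toSite v - unitVec κ) (β, x) (β', x')
              - symMixKerAt (ctr 4 Lc) Lc ρ' w (κ, (Lc : ℤ) • y + toSite v) (β, x) (β', x')))) =
        ((Lc : ℝ) ^ (3 + 1))⁻¹ * ∑ v ∈ box (3 + 1) Lc, ∑ κ : Fin (3 + 1),
          (symMixKerAt (ctr 4 Lc) Lc ρ' w (κ, (Lc : ℤ) • y + toSite v - unitVec κ) (β', x') (β, x)
              - symMixKerAt (ctr 4 Lc) Lc ρ' w (κ, (Lc : ℤ) • y + toSite v) (β', x') (β, x))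
        + ((Lc : ℝ) ^ (3 + 1))⁻¹ * ∑ v ∈ box (3 + 1) Lc, ∑ κ : Fin (3 + 1),
            (symMixKerAt (ctr 4 Lc) Lc ρ' w (κ, (Lc : ℤ) • y + toSite v - unitVec κ) (β, x) (β', x')
              - symMixKerAt (ctr 4 Lc) Lc ρ' w (κ, (Lc : ℤ) • y + toSite v) (β, x) (β', x')) := by
      rw [← mul_add, ← Finset.sum_add_distrib]
      congr 1
      refine Finset.sum_congr rfl fun v _ => ?_
      rw [← Finset.sum_add_distrib]
    rw [hsplit] at h
    linarith
  · rw [symRWof_apply, symRWof_apply, symWardM_inl_inr, symDatM_inl_inr, symWardM_inr, symDatM_inr]; ring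
  · rw [symRWof_apply, symRWof_apply, symWardM_inl_inr, symDatM_inl_inr, symWardM_inr, symDatM_inr]; ring
  · rw [symRWof_apply, symRWof_apply, symWardM_inr, symDatM_inr, symWardM_inr, symDatM_inr]; ring

/-! ## §4 The residual is a vertex family, constants uniform in the coarse site (no hypothesis) -/

section Class

omit [NeZero Lc] in
/-- [folklore] an1's sym mixed table, any bond `u`, is bi-localised at the coarse point `Lc•w` (rate `1∕2`, constant `symMixAbs·e^{6·4·Lc}`). -/
theorem biLoc_symMixFFAt_coarse (hLc : 1 ≤ Lc) (κ : Fin (3 + 1)) (u : Fin (3 + 1) → ℤ) (ρ' : Fin (3 + 1)) (w : Fin (3 + 1) → ℤ) :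
    BiLoc (symMixFFAt (ctr 4 Lc) Lc κ u ρ' w) ((Lc : ℤ) • w) ((Lc : ℤ) • w)
      (symMixAbs (ctr 4 Lc) Lc * Real.exp (6 * ((3 : ℝ) + 1) * Lc * 1)) (1 / 2) := by
  have h := biLoc_symMixFFAt (d := 3) hLc (ctrOff_mem_box (d := 4) hLc) zero_le_one κ u ρ' w
  rw [show toSite (ctrOff 4 Lc) = ctr 4 Lc from rfl] at h
  exact biLoc_absorb (mul_nonneg (symMixAbs_nonneg _ _) (Real.exp_pos _).le) zero_le_one (by simpa using h)

/-- [folklore] **THE LEFT SIDE IS A VERTEX FAMILY** with constants uniform in `y`: every one of the `2·4·|box|` terms of the block divergence is a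
table `symMixFFAt κ u ρ′ w` bi-localised at `Lc•w` (`biLoc_symMixFFAt_coarse`). -/
theorem vertexFamily_symWardM (hLc : 1 ≤ Lc) (y : Fin (3 + 1) → ℤ) :
    VertexFamily (symWardM Lc y) Lc
      (|(stepScale 3 Lc 0 * (Lc : ℝ) ^ (3 + 1))⁻¹| *
        ∑ _v ∈ box (3 + 1) Lc, ∑ _κ : Fin (3 + 1), (symMixAbs (ctr 4 Lc) Lc * Real.exp (6 * ((3 : ℝ) + 1) * Lc * 1)
          + symMixAbs (ctr 4 Lc) Lc * Real.exp (6 * ((3 : ℝ) + 1) * Lc * 1))) (1 / 2) := by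
  intro ρ' w
  have h2 : wM2 3 Lc 0 = 1 := by simp [BalabanStepW2.wM2]
  have hsum : BiLoc (fun x z a b => ∑ v ∈ box (3 + 1) Lc,
      divV (fun κ u => M2Of 3 Lc (symMixFFAt (ctr 4 Lc) Lc) 0 κ u ρ' w) ((Lc : ℤ) • y + toSite v) x z a b)
      ((Lc : ℤ) • w) ((Lc : ℤ) • w)
      (∑ _v ∈ box (3 + 1) Lc, ∑ _κ : Fin (3 + 1), (symMixAbs (ctr 4 Lc) Lc * Real.exp (6 * ((3 : ℝ) + 1) * Lc * 1)
          + symMixAbs (ctr 4 Lc) Lc * Real.exp (6 * ((3 : ℝ) + 1) * Lc * 1))) (1 / 2) := by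
    refine biLoc_finset_sum (box (3 + 1) Lc) fun v _ => ?_
    have e : divV (fun κ u => M2Of 3 Lc (symMixFFAt (ctr 4 Lc) Lc) 0 κ u ρ' w) ((Lc : ℤ) • y + toSite v)
        = fun x z a b => ∑ κ : Fin (3 + 1), (symMixFFAt (ctr 4 Lc) Lc κ ((Lc : ℤ) • y + toSite v - unitVec κ) ρ' w
            - symMixFFAt (ctr 4 Lc) Lc κ ((Lc : ℤ) • y + toSite v) ρ' w) x z a b := by
      funext x z a b
      rw [divV_apply]
      refine Finset.sum_congr rfl fun κ _ => ?_
      simp only [M2Of_apply, h2, one_smul, Pi.sub_apply]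
    rw [e]
    refine biLoc_finset_sum (Finset.univ : Finset (Fin (3 + 1))) fun κ _ => ?_
    exact biLoc_sub (biLoc_symMixFFAt_coarse hLc κ _ ρ' w) (biLoc_symMixFFAt_coarse hLc κ _ ρ' w)
  have hs := biLoc_smul hsum ((stepScale 3 Lc 0 * (Lc : ℝ) ^ (3 + 1))⁻¹)
  refine biLoc_weaken (K := symWardM Lc y ρ' w) ?_ le_rfl le_rfl
  intro x z a b
  have hx := hs x z a b
  have ew : symWardM Lc y ρ' w x z a b = ((stepScale 3 Lc 0 * (Lc : ℝ) ^ (3 + 1))⁻¹ •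
      fun x z a b => ∑ v ∈ box (3 + 1) Lc,
        divV (fun κ u => M2Of 3 Lc (symMixFFAt (ctr 4 Lc) Lc) 0 κ u ρ' w) ((Lc : ℤ) • y + toSite v) x z a b) x z a b := by
    simp only [symWardM, Pi.smul_apply, Finset.sum_apply]
  rw [ew]
  exact hx

omit [NeZero Lc] in
/-- [folklore] The half-indicator symbol `D_y = ½ Σ_v legInd ρ_c (Lc•y + v)` is bounded by `½·|box|`. -/
theorem abs_D_le (y z : Fin (3 + 1) → ℤ) (b : Fib 3) :
    |(((1 : ℝ) / 2) • ∑ v ∈ box (3 + 1) Lc, legInd (ctr 4 Lc) ((Lc : ℤ) • y + toSite v)) z b|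
      ≤ (1 / 2 : ℝ) * (box (3 + 1) Lc).card := by
  simp only [Pi.smul_apply, Finset.sum_apply, smul_eq_mul]
  rw [abs_mul, abs_of_pos (by norm_num : (0 : ℝ) < 1 / 2)]
  refine mul_le_mul_of_nonneg_left ?_ (by norm_num)
  calc |∑ v ∈ box (3 + 1) Lc, legInd (ctr 4 Lc) ((Lc : ℤ) • y + toSite v) z b|
      ≤ ∑ v ∈ box (3 + 1) Lc, |legInd (ctr 4 Lc) ((Lc : ℤ) • y + toSite v) z b| := Finset.abs_sum_le_sum_abs _ _
    _ ≤ ∑ _v ∈ box (3 + 1) Lc, (1 : ℝ) := Finset.sum_le_sum fun v _ => by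
        rw [legInd_apply]; split_ifs <;> simp
    _ = (box (3 + 1) Lc).card := by simp

/-- [folklore] **THE DATUM IS A VERTEX FAMILY** with constants uniform in `y`: `symHessFFAt … ρ′ w` is bi-localised at `Lc•w` (an1's `biLoc_symHessFFAt`) and the
symbol `D_y` is bounded by `½·|box|`. -/
theorem vertexFamily_symDatM (hLc : 1 ≤ Lc) (cΛ : ℝ) (y : Fin (3 + 1) → ℤ) :
    VertexFamily (symDatM Lc cΛ y) Lc
      (|cΛ| * (2 * (ell (3 + 1) Lc : ℝ) ^ 2 * Real.exp (4 * ((3 : ℝ) + 1) * Lc * (1 / 2))) * (2 * ((1 / 2 : ℝ) * (box (3 + 1) Lc).card))) (1 / 2) := by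
  intro ρ' w x z a b
  have hH := biLoc_symHessFFAt (d := 3) hLc ρ' w (ctrOff_mem_box (d := 4) hLc) (by norm_num : (0 : ℝ) ≤ 1 / 2) x z a b
  have hD1 := abs_D_le (Lc := Lc) y z b
  have hD2 := abs_D_le (Lc := Lc) y x a
  rw [symDatM_apply, abs_mul, abs_mul]
  have hdiff : |(((1 : ℝ) / 2) • ∑ v ∈ box (3 + 1) Lc, legInd (ctr 4 Lc) ((Lc : ℤ) • y + toSite v)) z b
      - (((1 : ℝ) / 2) • ∑ v ∈ box (3 + 1) Lc, legInd (ctr 4 Lc) ((Lc : ℤ) • y + toSite v)) x a|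
      ≤ 2 * ((1 / 2 : ℝ) * (box (3 + 1) Lc).card) := by
    refine (abs_sub _ _).trans ?_
    linarith
  have hC : 0 ≤ 2 * (ell (3 + 1) Lc : ℝ) ^ 2 * Real.exp (4 * ((3 : ℝ) + 1) * Lc * (1 / 2)) := by positivity
  calc |cΛ| * |symHessFFAt (ctr 4 Lc) Lc ρ' w x z a b| *
        |(((1 : ℝ) / 2) • ∑ v ∈ box (3 + 1) Lc, legInd (ctr 4 Lc) ((Lc : ℤ) • y + toSite v)) z b
          - (((1 : ℝ) / 2) • ∑ v ∈ box (3 + 1) Lc, legInd (ctr 4 Lc) ((Lc : ℤ) • y + toSite v)) x a|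
      ≤ |cΛ| * (2 * (ell (3 + 1) Lc : ℝ) ^ 2 * Real.exp (4 * ((3 : ℝ) + 1) * Lc * (1 / 2))
          * Real.exp (-(1 / 2) * (l1 (x - (Lc : ℤ) • w) + l1 (z - (Lc : ℤ) • w)))) * (2 * ((1 / 2 : ℝ) * (box (3 + 1) Lc).card)) := by
        refine mul_le_mul (mul_le_mul_of_nonneg_left hH (abs_nonneg _)) hdiff (abs_nonneg _) ?_
        exact mul_nonneg (abs_nonneg _) (mul_nonneg hC (Real.exp_pos _).le)
    _ = _ := by ring

/-- [folklore] **THE RESIDUAL IS A VERTEX FAMILY, CONSTANTS UNIFORM IN THE COARSE SITE** — the END's binder `hclsW₀` for `RW₀ := symRWof Lc cΛ`, with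
NO hypothesis (finite-range tables). -/
theorem vertexFamily_symRWof (hLc : 1 ≤ Lc) (cΛ : ℝ) : ∃ C δ : ℝ, 0 < δ ∧ ∀ y, VertexFamily (symRWof Lc cΛ y) Lc C δ := by
  refine ⟨|(stepScale 3 Lc 0 * (Lc : ℝ) ^ (3 + 1))⁻¹| *
        ∑ _v ∈ box (3 + 1) Lc, ∑ _κ : Fin (3 + 1), (symMixAbs (ctr 4 Lc) Lc * Real.exp (6 * ((3 : ℝ) + 1) * Lc * 1)
          + symMixAbs (ctr 4 Lc) Lc * Real.exp (6 * ((3 : ℝ) + 1) * Lc * 1))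
      + |cΛ| * (2 * (ell (3 + 1) Lc : ℝ) ^ 2 * Real.exp (4 * ((3 : ℝ) + 1) * Lc * (1 / 2))) * (2 * ((1 / 2 : ℝ) * (box (3 + 1) Lc).card)),
    1 / 2, by norm_num, fun y ρ' w => ?_⟩
  have h := biLoc_sub (vertexFamily_symWardM hLc y ρ' w) (vertexFamily_symDatM hLc cΛ y ρ' w)
  exact h

end Class

/-! ## §5 The three mixed Ward binders of the row END from the bond-level law -/
/-- [folklore] **(WM-bond) ⟹ THE THREE MIXED WARD BINDERS** (`hclsW₀`, `hRW₀p`, `hM₂0`) of the sym row root at level `0`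
with `RM 0 := symRWof Lc cΛ`.  CONDITIONAL on the bond-level Ward law (WM-bond)_sym of the sym mixed table (a HYPOTHESIS here; an1's `SymMixedWardSiteLaw.symBondWardM` at `cΛ = 2∕Lc⁴`). -/
theorem mixedWardBinders_of_bondLaw (hLc : 1 ≤ Lc) (cΛ : ℝ)
    (hWM : ∀ (y : Fin (3 + 1) → ℤ) (ρ' : Fin (3 + 1)) (w : Fin (3 + 1) → ℤ) (β : Fin (3 + 1)) (x : Fin (3 + 1) → ℤ) (β' : Fin (3 + 1))
      (x' : Fin (3 + 1) → ℤ),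
      ((Lc : ℝ) ^ (3 + 1))⁻¹ * (∑ v ∈ box (3 + 1) Lc, ∑ κ : Fin (3 + 1),
          ((symMixKerAt (ctr 4 Lc) Lc ρ' w (κ, (Lc : ℤ) • y + toSite v - unitVec κ) (β, x) (β', x')
              - symMixKerAt (ctr 4 Lc) Lc ρ' w (κ, (Lc : ℤ) • y + toSite v) (β, x) (β', x'))
            + (symMixKerAt (ctr 4 Lc) Lc ρ' w (κ, (Lc : ℤ) • y + toSite v - unitVec κ) (β', x') (β, x)
              - symMixKerAt (ctr 4 Lc) Lc ρ' w (κ, (Lc : ℤ) • y + toSite v) (β', x') (β, x)))) =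
        2 * (cΛ * symHessKerAt (ctr 4 Lc) Lc ρ' w (β, x) (β', x') *
          ((1 / 2 : ℝ) * (∑ v ∈ box (3 + 1) Lc, (if x' = (Lc : ℤ) • y + toSite v then (1 : ℝ) else 0))
            - (1 / 2 : ℝ) * (∑ v ∈ box (3 + 1) Lc, (if x = (Lc : ℤ) • y + toSite v then (1 : ℝ) else 0))))) :
    (∃ C δ : ℝ, 0 < δ ∧ ∀ y, VertexFamily (symRWof Lc cΛ y) Lc C δ)
      ∧ (∀ y ρ' w, trK (symRWof Lc cΛ y ρ' w) = -sgnK (symRWof Lc cΛ y ρ' w))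
      ∧ (∀ (y : Fin (3 + 1) → ℤ) (ρ' : Fin (3 + 1)) (w : Fin (3 + 1) → ℤ),
          (stepScale 3 Lc 0 * (Lc : ℝ) ^ (3 + 1))⁻¹ • ∑ v ∈ box (3 + 1) Lc,
              divV (fun κ u => M2Of 3 Lc (symMixFFAt (ctr 4 Lc) Lc) 0 κ u ρ' w) ((Lc : ℤ) • y + toSite v) =
            comp (M1Of 3 Lc (symHessFFAt (ctr 4 Lc) Lc) cΛ 0 ρ' w)
                (diagK (((1 : ℝ) / 2) • ∑ v ∈ box (3 + 1) Lc, legInd (ctr 4 Lc) ((Lc : ℤ) • y + toSite v)))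
              - comp (diagK (((1 : ℝ) / 2) • ∑ v ∈ box (3 + 1) Lc, legInd (ctr 4 Lc) ((Lc : ℤ) • y + toSite v)))
                (M1Of 3 Lc (symHessFFAt (ctr 4 Lc) Lc) cΛ 0 ρ' w)
              + symRWof Lc cΛ y ρ' w) :=
  ⟨vertexFamily_symRWof hLc cΛ, parityOdd_symRWof_of_bondLaw cΛ hWM, symWardMixed_symRWof cΛ⟩

end

end Summit.QuantumFields.BalabanUV.Beta.SymMixedWardPacking
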